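import Summits.BirchSwinnertonDyer.BirchSwinnertonDyer.Theorems.KatoDescentTamePotSupersingularJetchevIrreducibleProp47ClassChoiceZhang
import Summits.BirchSwinnertonDyer.BirchSwinnertonDyer.Theorems.KatoDescentTamePotSupersingularJetchevIrreducibleProp44AHalfRows
import Summits.BirchSwinnertonDyer.BirchSwinnertonDyer.Theorems.KolyvaginRoadThreeLevelData
import Summits.BirchSwinnertonDyer.BirchSwinnertonDyer.Theorems.Rank1ResidualJetRingClassFields
import Summits.BirchSwinnertonDyer.Rank1Residual.X11b.KolyvaginHeegnerTowerData
import HarnessLib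

/-!
# Crux `JetchevIrreducibleReadingByName` (item 20165, shared K8-t′ / K9), stub S5 — the PRIMED (B)-ONLY reading `h47P`
# (v7 candidate `stub_prop47IrredP`) FROM the family-format ORDER FORM of McCallum Prop. 4.4 (x11b3's `h44` shape,
# Zhang-keyed) — seat `bsd-potss-k8t-c4` g11; `--supports 20165`, helper; route-free; nothing booked, no item closed,
# BSD is not proved by any of this

WHY. S5's (B)-conjunct asks, for an ARBITRARY compatible pair `(d, d')` of Kolyvagin–Heegner data at conductors `m`, `mℓ`
(all primes Zhang–Kolyvagin of index `≥ M`) and the place `λ ∋ ℓ`: `p^j•c_M(mℓ) ∈ Ker_λ ↔ p^j•c_M(m) ∈ Ker_λ`. What the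
`h44` programme delivers (x11b3 `KolyvaginH44Concrete.h44_concrete_of_traceRelation_of_congruence`, Gross-keyed; cell
`bsd-stepL` corner-p1 g9/g10's Zhang re-key in progress: p530739, p532010, p532737) is McCallum Prop. 4.4 in ORDER FORM
— `p^a c_M(m') ∈ Sel_λ ↔ p^a c_M(m'/ℓ) ∈ Ker_λ` — for ONE COHERENT FAMILY of data on the divisors of a level. This file
is the PLUMBING between the two shapes, so that S5 closes the moment the family statement does (labelled remainder there:
Gross 1991 Prop. 3.7 (2)): given the pair, build a coherent family `d̃` on the divisors of `n = mℓ` (x11b3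
`RingClassTower.exists_coherent_kolyvaginHeegnerData_erase`, CM input points from the PROVED Gross §3 facts via
`nonempty_kolyvaginHeegnerData_of_grossCM`), apply the family statement at `(n, ℓ)`, and transport along
`c(d') ~ c(d̃ n)`, `c(d) ~ c(d̃ m)` (unit multiples: this seat's Zhang re-key `zsmul_kolyvaginClass_mem_iff_zhang` of
x11b3's choice-independence, admissibility from irreducibility by x11b3's `NoTorsionIrr`) and the (A)-half at the top
(this seat g10's `zsmul_kolyvaginClass_mem_selmerLocalKer_iff_mem_torsionLocalKer_of_irreducible_of_heegner`). The pair's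
compatibility binders are not even used.

WHAT IS PROVED. `h47P_of_familyH44`: the closed statement `h47P` (= `Sig.stub_prop47IrredP` of the v7 candidate, the first
binder of this seat's re-keyed chain `…_of_prop47P`, VERBATIM) from the closed family statement `hfam` (x11b3's
`h44_concrete` CONCLUSION with the Zhang antecedent, over the crux's row frame: `K` Heegner with `d_K ∉ {−3,−4}`, odd `p`,
`E[p]` irreducible, `p ∣ N_E`, `M ≥ 1`; no `hA`/`hPt`/`hI`/`hγ` binders — whoever proves `hfam` discharges them).
CONDITIONAL on `hfam`; nothing asserted about any curve; S5, the crux and BSD stay open.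

References: [cite: McCallumLMS1991, §4 Prop. 4.4, (4)–(6)] [cite: GrossLMS1991, §4 (4.1) and after, Prop. 3.6, Prop. 3.7,
Lemma 4.3] [cite: Jetchev2008, Prop. 4.4, Prop. 4.7, Rem. 6.2] [cite: WZhang2014, Notations (xii)].
-/

set_option autoImplicit false
-- the Theorems directory repeats the summit name (sibling precedent `KatoDescentPotSupersingularAssembly.lean`)
set_option linter.dupNamespace false

noncomputable section

open scoped Classical Pointwise

open WeierstrassCurve NumberField IsDedekindDomain Field
  Literature.NumberTheory.GaloisRepresentations Literature.NumberTheory.EllipticCurves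
  Literature.NumberTheory.EllipticCurves.KolyvaginCocycle Literature.NumberTheory.EllipticCurves.ModularForms
  Summit.BirchSwinnertonDyer.Rank1Residual Summit.BirchSwinnertonDyer.Rank1Residual.X11b
  Summit.BirchSwinnertonDyer.Rank1Residual.X11b.Three

namespace Summit.BirchSwinnertonDyer.BirchSwinnertonDyer.Theorems.JetchevIrreducibleProp44

/-- **`h47P` (S5 primed, (B)-only) ⟸ the family-format order form of Prop. 4.4 on the rows.** Given a compatible pair
`(d, d')` at `(m, mℓ)`, a coherent family `d̃` on the divisors of `mℓ` is built from the proved Gross §3 CM facts; the family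
statement at `(mℓ, ℓ)` gives `p^j c(d̃ mℓ) ∈ Sel_λ ↔ p^j c(d̃ m) ∈ Ker_λ`; the (A)-half (p530898) turns `Sel_λ` into
`Ker_λ` at the top; and the classes of `d'`/`d̃ mℓ` resp. `d`/`d̃ m` differ by units (`zsmul_kolyvaginClass_mem_iff_zhang`),
so the memberships transfer. CONDITIONAL on `hfam`. [cite: McCallumLMS1991, §4 Prop. 4.4] [cite: GrossLMS1991, §4 (4.1)]
[cite: Jetchev2008, Prop. 4.7] -/
theorem h47P_of_familyH44
    (hfam : ∀ (W : WeierstrassCurve ℚ) [W.IsElliptic] [W.IsGloballyMinimal] [NeZero (W.conductorNorm ℤ)],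
        ∀ (K : Type) [Field K] [NumberField K], IsImaginaryQuadratic K →
        NumberField.discr K ≠ -3 → NumberField.discr K ≠ -4 →
        SatisfiesHeegnerHypothesis (W.conductorNorm ℤ) K →
        ∀ (p : ℕ) [Fact p.Prime], p ≠ 2 → W.HasIrreducibleModPGaloisRep p → (p : ℤ) ∣ W.conductorNorm ℤ →
        ∀ (Dt : ModularParametrizationData W (W.conductorNorm ℤ)) (β : ℤ) (ι : K →+* ℂ)
          (M : ℕ), 1 ≤ M →
        ∀ (n : ℕ), Squarefree n →
          (∀ q ∈ n.primeFactors, Zhang2014.IsKolyvaginPrime (W.conductorNorm ℤ) W K p q ∧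
            M ≤ Zhang2014.kolyvaginIndex W p q) →
        ∀ (d : (m : ℕ) → m ∣ n → KolyvaginHeegnerData Dt β ι m),
          (∀ (m : ℕ) (hm : m ∣ n) (ℓ : ℕ) (hℓ : ℓ ∈ m.primeFactors)
            (hle : ringClassField K ι (m / ℓ) ≤ ringClassField K ι m),
            letI : Algebra K ℂ := ι.toAlgebra
            (d m hm).toGeomPoints
                (KolyvaginOperator.derivedPoint (pointGalHom W (ringClassField K ι m)) (d m hm).σ (m / ℓ)
                  (d m hm).S
                  (WeierstrassCurve.Affine.Point.map (W' := W)
                    ((RingClassField.inclusion ι hle).restrictScalars ℚ)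
                    (d (m / ℓ) ((Nat.div_dvd_of_dvd (Nat.dvd_of_mem_primeFactors hℓ)).trans hm)).y)) =
              (d (m / ℓ) ((Nat.div_dvd_of_dvd (Nat.dvd_of_mem_primeFactors hℓ)).trans hm)).toGeomPoints
                (d (m / ℓ) ((Nat.div_dvd_of_dvd (Nat.dvd_of_mem_primeFactors hℓ)).trans hm)).derivedPoint) →
        ∀ (m : ℕ) (hm : m ∣ n) (ℓ : ℕ), ℓ.Prime → ∀ (hℓm : ℓ ∣ m) (v : HeightOneSpectrum (𝓞 K)),
          (ℓ : 𝓞 K) ∈ v.asIdeal → ∀ a : ℕ,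
          (((p : ℤ) ^ a) • (d m hm).kolyvaginClass (Fact.out : p.Prime) M ∈
              selmerLocalKer (W.baseChange K) (v.adicCompletion K) ((p ^ M : ℕ) : ℤ) ↔
            ((p : ℤ) ^ a) • (d (m / ℓ) ((Nat.div_dvd_of_dvd hℓm).trans hm)).kolyvaginClass
                (Fact.out : p.Prime) M ∈
              (W.baseChange K).torsionLocalKer (v.adicCompletion K) ((p ^ M : ℕ) : ℤ))) :
    ∀ (W : WeierstrassCurve ℚ) [W.IsElliptic] [W.IsGloballyMinimal] [NeZero (W.conductorNorm ℤ)],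
        ¬ W.HasCM →
        ∀ (K : Type) [Field K] [NumberField K], IsImaginaryQuadratic K →
        NumberField.discr K ≠ -3 → NumberField.discr K ≠ -4 →
        SatisfiesHeegnerHypothesis (W.conductorNorm ℤ) K →
        ∀ (p : ℕ) [Fact p.Prime], p ≠ 2 → W.HasIrreducibleModPGaloisRep p → (p : ℤ) ∣ W.conductorNorm ℤ →
        ∀ (Dt : ModularParametrizationData W (W.conductorNorm ℤ)) (β : ℤ) (ι : K →+* ℂ)
          (M : ℕ), 1 ≤ M →
        ∀ (m l : ℕ), Squarefree (m * l) → l.Prime → ¬ l ∣ m →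
          (∀ l' ∈ (m * l).primeFactors, Zhang2014.IsKolyvaginPrime (W.conductorNorm ℤ) W K p l' ∧
            M ≤ Zhang2014.kolyvaginIndex W p l') →
        ∀ (d : KolyvaginHeegnerData Dt β ι m) (d' : KolyvaginHeegnerData Dt β ι (m * l)),
          (∀ l' ∈ m.primeFactors, ∀ (x : ringClassField K ι m) (x' : ringClassField K ι (m * l)),
            (x : ℂ) = x' → ((d'.σ l' x' : ringClassField K ι (m * l)) : ℂ) = (d.σ l' x : ℂ)) →
          (∀ s ∈ d.S, ∃ s' ∈ d'.S, ∀ (x : ringClassField K ι m) (x' : ringClassField K ι (m * l)),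
            (x : ℂ) = x' → ((s' x' : ringClassField K ι (m * l)) : ℂ) = (s x : ℂ)) →
          (∀ s' ∈ d'.S, ∃ s ∈ d.S, ∀ (x : ringClassField K ι m) (x' : ringClassField K ι (m * l)),
            (x : ℂ) = x' → ((s' x' : ringClassField K ι (m * l)) : ℂ) = (s x : ℂ)) →
          (∀ (x : ringClassField K ι m) (x' : ringClassField K ι (m * l)),
            (x : ℂ) = x' → d'.emb x' = d.emb x) →
        ∀ (v : HeightOneSpectrum (𝓞 K)), (l : 𝓞 K) ∈ v.asIdeal →
        ∀ (j : ℕ),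
          (((p ^ j : ℕ) : ℤ) • d'.kolyvaginClass (Fact.out : p.Prime) M ∈
              (W.baseChange K).torsionLocalKer (v.adicCompletion K) ((p ^ M : ℕ) : ℤ) ↔
            ((p ^ j : ℕ) : ℤ) • d.kolyvaginClass (Fact.out : p.Prime) M ∈
              (W.baseChange K).torsionLocalKer (v.adicCompletion K) ((p ^ M : ℕ) : ℤ)) := by
  intro W _ _ _ _ K _ _ hK hD3 hD4 hH p _ hp2 hirr hpN Dt β ι M hM m l hml hl hlm hK' d d' _ _ _ _ v hv j
  have hp : p.Prime := Fact.out
  have hn0 : m * l ≠ 0 := hml.ne_zero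
  have hmn : m ∣ m * l := dvd_mul_right m l
  have hln : l ∈ (m * l).primeFactors := Nat.mem_primeFactors.mpr ⟨hl, dvd_mul_left l m, hn0⟩
  have hpN' : p ∣ W.conductorNorm ℤ := Int.natCast_dvd_natCast.mp hpN
  have hinert : ∀ q ∈ (m * l).primeFactors, (Ideal.span {(q : 𝓞 K)}).IsPrime :=
    fun q hq ↦ (hK' q hq).1.2.2.2.2.1
  have hND : IsCoprime (W.conductorNorm ℤ : ℤ) (NumberField.discr K) :=
    KolyvaginAssembly.isCoprime_discr_of_satisfiesHeegnerHypothesis hK hH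
  have hD : NumberField.discr K < -4 := KolyvaginAssembly.discr_lt_neg_four hK ⟨hD3, hD4⟩
  -- CM input points at every divisor (Gross §3 facts PROVED), and a COHERENT family `dd` on the divisors of `mℓ`
  have hne : ∀ k : ℕ, k ∣ m * l → Nonempty (KolyvaginHeegnerData Dt β ι k) := fun k hk ↦
    BirchSwinnertonDyer.Theorems.nonempty_kolyvaginHeegnerData_of_grossCM
      (phi_heegnerPointOfConductor_mem_range_map_ringClassField_holds (W.conductorNorm ℤ) W K)
      exists_generator_ringClassGalOver_holds hK hH Dt β ι d.dvd_sq_sub (hml.squarefree_of_dvd hk)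
      (fun q hq ↦ hinert q (Nat.primeFactors_mono hk hn0 hq))
  obtain ⟨dd, -, -, hcoh⟩ := RingClassTower.exists_coherent_kolyvaginHeegnerData_erase Dt hK ι hml hinert
    d.dvd_sq_sub (fun k hk ↦ (hne k hk).some.y) (fun k hk ↦ (hne k hk).some.map_y)
  -- the family statement at `(mℓ, ℓ)`
  have key := hfam W K hK hD3 hD4 hH p hp2 hirr hpN Dt β ι M hM (m * l) hml hK' dd
    (fun k hk ℓ hℓ hle ↦ (hcoh k hk ℓ hℓ hle).2) (m * l) dvd_rfl l hl (dvd_mul_left l m) v hv j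
  -- admissibility at every divisor (irreducibility + `p` unramified in `K` + `p ∤ mℓ`)
  have hpn : ¬ p ∣ m * l := fun h ↦ (hK' p (Nat.mem_primeFactors.mpr ⟨hp, h, hn0⟩)).1.2.2.2.1 rfl
  have hA : ∀ (k : ℕ) (hk : k ∣ m * l),
      IsAdmissible (absoluteGaloisGroup K) (dd k hk).pointsSubgroup ((p ^ M : ℕ) : ℤ) := fun k hk ↦
    NoTorsionIrr.isAdmissible_pointsSubgroup_of_hasIrreducibleModPGaloisRep (dd k hk) hK
      (ne_zero_of_dvd_ne_zero hn0 hk) hp hp2 hirr (WeierstrassCurve.exists_weilPairing_holds W p)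
      (X11b.isUnramifiedIn_of_satisfiesHeegnerHypothesis_of_dvd hK hH hp hpN') (fun h ↦ hpn (h.trans hk)) M
  -- choice-independence up to units: `d'` vs `dd (mℓ)`, `d` vs `dd m`
  have top := zsmul_kolyvaginClass_mem_iff_zhang hK ι Dt hp hM hND hD hml hK' dd dvd_rfl d' (hA _ dvd_rfl)
  have bot := zsmul_kolyvaginClass_mem_iff_zhang hK ι Dt hp hM hND hD hml hK' dd hmn d (hA _ hmn)
  -- the (A)-half at the top for `dd (mℓ)` (k8t-c4 g10)
  haveI : ∀ k : ℕ, NumberField (ringClassField K ι k) := fun k ↦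
    Summit.BirchSwinnertonDyer.Rank1Residual.JET.numberField_ringClassField K hK ι k
  have hAtop := zsmul_kolyvaginClass_mem_selmerLocalKer_iff_mem_torsionLocalKer_of_irreducible_of_heegner hK ι W
    hD3 hD4 hH hp2 hirr hpN' Dt β hml hln hK' (dd (m * l) dvd_rfl) v hv ((p : ℤ) ^ j)
  -- re-indexing `dd (mℓ/ℓ) = dd m`
  have hcast : ∀ {k₁ k₂ : ℕ} (h : k₁ = k₂) (h₁ : k₁ ∣ m * l) (h₂ : k₂ ∣ m * l) (t : ℤ)
      (H : AddSubgroup (galH1Torsion (W.baseChange K) ((p ^ M : ℕ) : ℤ))),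
      t • (dd k₁ h₁).kolyvaginClass hp M ∈ H ↔ t • (dd k₂ h₂).kolyvaginClass hp M ∈ H := by
    intro k₁ k₂ h h₁ h₂ t H
    subst h
    rfl
  have hml' : m * l / l = m := Nat.mul_div_cancel m hl.pos
  rw [show ((p ^ j : ℕ) : ℤ) = (p : ℤ) ^ j from Nat.cast_pow p j]
  exact (top _ _).trans <| hAtop.symm.trans <| key.trans <|
    (hcast hml' _ hmn _ _).trans (bot _ _).symm

end Summit.BirchSwinnertonDyer.BirchSwinnertonDyer.Theorems.JetchevIrreducibleProp44

end
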